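import Summits.HodgeConjecture.HodgeConjecture.Theses.LinearSystemTorelli
import Literature.AlgebraicGeometry.HodgeTheory.ComplexGysinHodgeType
import Literature.AlgebraicGeometry.HodgeTheory.VanishingCohomologyNontrivialProofs
import Literature.AlgebraicTopology.SingularHomology.PoincareDualityCorollaries

/-!
# Crux `TranscendentalOrSupported` (stmt-HodgeConjecture-10853), line `Sketch` — stub
# `stub_doublePerp`: `S = S⊥⊥` for the Poincaré pairing of `X(ℂ)`

For `X` smooth projective of dimension `n`, an orientation family `μ`, `k + l = 2n`, a subspace
`S ⊆ Hᵏ(X(ℂ); ℂ)` and a class `w ∈ Hᵏ(X(ℂ); ℂ)`: if `⟨w ⌣ c, [X(ℂ)]⟩ = 0` for every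
`c ∈ Hˡ(X(ℂ); ℂ)` which is right-orthogonal to `S` (`⟨s ⌣ c, [X(ℂ)]⟩ = 0` for all `s ∈ S`), then
`w ∈ S`.

PROOF (pure linear algebra). The cup product pairing `B = cupPairing (μ hX) h` of the closed oriented
`2n`-manifold `X(ℂ)` is perfect over the field `ℂ` (Hatcher Prop. 3.38, the tree's PROVED
`isPerfPair_cupPairing_of_field_holds`; instances `CompactSpace`/`T2Space`/`ChartedSpace` on `X(ℂ)`
as in `eq_zero_of_forall_cupPairing_eq_zero`), so `B.flip : Hˡ → (Hᵏ)^*` is surjective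
(`LinearMap.IsPerfPair.bijective_right`). By `W = W⁰⁰`
(`Subspace.forall_mem_dualAnnihilator_apply_eq_zero_iff`) it suffices that every functional `φ` in the
annihilator of `S` kills `w`; writing `φ = B.flip c`, the class `c` is right-orthogonal to `S`, so
`φ w = ⟨w ⌣ c, [X(ℂ)]⟩ = 0` by hypothesis.
-/

noncomputable section

-- `Summit.HodgeConjecture.HodgeConjecture.Theorems` is the mandated namespace (single-problem summit:
-- Problem = Summit), flagged by `linter.dupNamespace`; restated for stand-alone elaboration.
set_option linter.dupNamespace false

open Literature.AlgebraicGeometry.Motives Literature.AlgebraicGeometry.HodgeTheory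
open Literature.AlgebraicTopology.SingularHomology

namespace Summit.HodgeConjecture.HodgeConjecture.Theorems

/-- **`S = S⊥⊥` for the Poincaré pairing.** For `X` smooth projective of dimension `n`, an
orientation family `μ`, `k + l = 2n`, a subspace `S ⊆ Hᵏ(X(ℂ); ℂ)` and `w ∈ Hᵏ(X(ℂ); ℂ)`: if
`⟨w ⌣ c, [X(ℂ)]⟩ = 0` for every `c ∈ Hˡ(X(ℂ); ℂ)` with `⟨s ⌣ c, [X(ℂ)]⟩ = 0` for all `s ∈ S`, then
`w ∈ S`. The cup pairing of the closed oriented manifold `X(ℂ)` is perfect over `ℂ`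
(`isPerfPair_cupPairing_of_field_holds`, Hatcher Prop. 3.38), so every functional annihilating `S`
is `⟨- ⌣ c, [X(ℂ)]⟩` for a `c` right-orthogonal to `S`, and `W = W⁰⁰`
(`Subspace.forall_mem_dualAnnihilator_apply_eq_zero_iff`). -/
theorem stub_doublePerp :
    ∀ (μ : OrientationFamily) ⦃n : ℕ⦄ ⦃X : SchemeOver ℂ⦄ (hX : IsSmoothProjective n X) ⦃k l : ℕ⦄
    (h : k + l = 2 * n) (S : Submodule ℂ (complexBetti X k)) (w : complexBetti X k),
    (∀ c : complexBetti X l, (∀ s ∈ S, cupPairing (μ hX) h s c = 0) → cupPairing (μ hX) h w c = 0) →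
    w ∈ S := by
  intro μ n X hX k l h S w hw
  letI := hX.chartedSpace
  haveI := ComplexPoints.compactSpace_of_isSmoothProjective hX
  haveI := ComplexPoints.t2Space_of_isSmoothProjective hX
  have hP : (cupPairing (μ hX) h).IsPerfPair := isPerfPair_cupPairing_of_field_holds
  rw [← Subspace.forall_mem_dualAnnihilator_apply_eq_zero_iff]
  intro φ hφ
  -- `φ = ⟨- ⌣ c, [X(ℂ)]⟩` for some `c`, by perfectness of the pairing
  obtain ⟨c, rfl⟩ := hP.bijective_right.2 φ
  rw [LinearMap.flip_apply]
  refine hw c fun s hs ↦ ?_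
  have hsc := (Submodule.mem_dualAnnihilator _).1 hφ s hs
  rwa [LinearMap.flip_apply] at hsc

end Summit.HodgeConjecture.HodgeConjecture.Theorems

end
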